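import Summits.QuantumFields.YangMills.Theorems.PoincareLipschitzLeungXinSphereIdentity

/-!
# Crux `HistoryTailL` (stmt-QuantumFields-19936), K2 organ of record «LOC-REG-MIN» (route crux `PoincareLipschitz.BlockLipschitzL`, stmt-QuantumFields-23533):
# THE STABILITY (LEUNG–XIN ∕ KAJIGAYA) INEQUALITY ON A FINITE GRAPH, QUANTITATIVE WITH A CUTOFF —
# `Σ_b η_xη_y·e_b·(1 + e_b/2) ≤ 3·Σ_b c_b·(η_x − η_y)²` for a map into `S³` that is energy-minimal along the four conformal variations

Cell `ym3-torus` (YM ladder rung R3 = continuum SU(2) Yang–Mills on the three-torus — a RUNG, NOT the Clay problem: not d = 4, not infinite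
volume, not a mass gap), LEAD seat `ym-ust-19936-w1` gen 8; `--supports stmt-QuantumFields-19936 --as helper`; THEOREMS ONLY, definition-free;
imports ✓p695660 `…LeungXinSphereIdentity` only.

WHY.  LOC-REG-MIN (card v1.37 (d)) — the a-priori chart at box-ℓ²-orbit minimisers — is, after the `SU(2) → S³ ⊂ ℝ⁴` dictionary, a statement about
maps `u : V → S³` on a finite graph (bonds `B`, `src tgt : B → V`) that MINIMISE the (twisted) discrete Dirichlet energy `Σ_b |u_x − Φ_b u_y|²` under
variations supported in a ball.  Its first analytic step is the STABILITY CACCIOPPOLI: normalised energy on a ball is bounded by stability ALONE.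
Print: Xin 1980 ∕ Leung 1982 (continuum), and on finite weighted graphs T. Kajigaya, Ann. Mat. Pura Appl. (2023), Thm 1.2 ∕ Cor. 4.4 — «no non-constant
stable discrete harmonic map into `Sⁿ`, `n ≥ 3`» (qualitative; located by ★w5-19936 g11, memo `LOC-REG-FLAT-SHADOW-LOCATE-w5g11.md`).  THIS FILE is the
quantitative untwisted graph form with an arbitrary vertex weight `η` (the cutoff):

  ★★★ `graph_stability`:  if for each coordinate field `a ∈ {0,1,2,3}` and EVERY real `t` the varied map
  `U_t^a(x) := (1 + t²|V_a(x)|²)^{−1/2}·(u_x + t·V_a(x))`, `V_a(x) := η_x·(e_a − (e_a·u_x)u_x)`, does not increase the bond correlation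
  `Σ_b U(src b)·U(tgt b)` (⇔ does not decrease the energy `Σ_b |U_x − U_y|²`, all vectors being unit), then
  `Σ_b η_{src b}η_{tgt b}·e_b·(1 + e_b/2) ≤ 3·Σ_b c_b·(η_{src b} − η_{tgt b})²`,   `e_b = |u_x − u_y|²`, `c_b = u_x·u_y`.

With `η` = a cutoff of a ball `B_R` (`|η_x − η_y| ≤ 2/R` on bonds, `η = 1` on `B_{R/2}`) the right side is `≤ 12·#bonds(B_R)/R² ≍ R^{d−2}`: the energy in
`B_{R/2}` is bounded by a constant times `R^{d−2}` with NO energy hypothesis.  The TWISTED form (bond isometries `Φ_b ∈ SO(4)`, defect `6Σ η_xη_y‖Φ_b − 1‖²`)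
slots into the same proof through ★w8-19936 g6's per-bond twisted identity (in flight); the dictionary `‖V − hWh'*‖ = |h − Φ(h')|` and the ball
bookkeeping are the LOC-REG-MIN pen's.

PROOF (no calculus).  Minimality at `t` and `−t` plus ✓`varPt_dot_varPt_add_neg` (the odd orders cancel EXACTLY) give, per field `a`,
`Σ_b [(c_b + t²k_b)·ρ_b(t) − c_b] ≤ 0` with `k_b = V_a(x)·V_a(y)`, `ρ_b = (1+t²|V_a(x)|²)^{−1/2}(1+t²|V_a(y)|²)^{−1/2}`; the removable singularity is
removed ALGEBRAICALLY (`key_identity`: `(c + t²k)ρ − c = t²·ρ·(k − c(a+b+t²ab)/(1 + √(1+t²a)√(1+t²b)))`), the bracket is continuous in `t` with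
value `k − c(a+b)/2` at `0`, so `Σ_b (k_b − c_b(|V_a(x)|² + |V_a(y)|²)/2) ≤ 0`; summing over `a` is ✓`sum_bondHessian_eq` ∕ ✓`sum_secondVariation_eq`.

* §1 `key_identity`, `continuous_bracket`, `bracket_zero` — one bond, one field, parameter `t`.
* §2 `le_of_forall_ne_zero` — a continuous function `≤ 0` off `0` is `≤ 0` at `0`.
* §3 ★★ `sum_hessianForm_nonpos_of_forall_dot_le` — THE ABSTRACT `t → 0` STEP (★w8-19936 g6's cut, so that the twisted Caccioppoli is a knit): for ANY
  families `p q v w : ι → ℝ⁴` on a finite set `s`, if `Σ_{b∈s} γ_{p_b}^{v_b}(t)·γ_{q_b}^{w_b}(t) ≤ Σ_{b∈s} p_b·q_b` for every `t`, then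
  `Σ_{b∈s} (2·v_b·w_b − (p_b·q_b)(|v_b|² + |w_b|²)) ≤ 0` (no unit ∕ orthogonality hypothesis needed for this algebraic step).
* §4 `varied_dot_self` (the varied map is unit-valued), ★★★ `graph_stability` (§3 at `v_b := η_x·v_a(u_x)`, `w_b := η_y·v_a(u_y)`, summed over `a`).
HONEST SCOPE.  Finite-dimensional algebra + one continuity argument; nothing of LOC-REG-MIN, `hG`, `BlockLipschitzL`, `HistoryTailL` or any summit
statement is proved.  YM₃ on T³ is rung R3, NOT the Clay problem.

References: Y. L. Xin, Duke Math. J. **47** (1980) 609–613 [Xin1980]; T. Kajigaya, Ann. Mat. Pura Appl. (2023), doi:10.1007/s10231-023-01374-3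
(arXiv:2306.14098), Thm 1.2; T. Bałaban, Commun. Math. Phys. **98** (1985) 17–51 [Balaban1985Averaging] §3.
-/

set_option autoImplicit false

open scoped BigOperators Topology
open Finset Filter

namespace Summit.QuantumFields.YangMills.Theorems.PoincareLipschitzLeungXinGraphStability

open Summit.QuantumFields.YangMills.Theorems.PoincareLipschitzLeungXinSphereIdentity
  (sum_bondHessian_eq sum_secondVariation_eq varPt_dot_self varPt_dot_varPt_add_neg tang_dot_self_pt)

/-! ## §1 One bond, one field: the removable singularity removed algebraically -/

/-- **KEY IDENTITY**: for `a, b ≥ 0` and reals `c, k, t`,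
`(c + t²k)·(√(1+t²a))⁻¹(√(1+t²b))⁻¹ − c = t²·[(√(1+t²a))⁻¹(√(1+t²b))⁻¹·(k − c·(a + b + t²ab)/(1 + √(1+t²a)·√(1+t²b)))]`
(because `(1+t²a)(1+t²b) − 1 = t²(a + b + t²ab)` and `ρ·√·√ = 1`). [folklore] -/
theorem key_identity (c k a b t : ℝ) (ha : 0 ≤ a) (hb : 0 ≤ b) :
    (c + t ^ 2 * k) * ((Real.sqrt (1 + t ^ 2 * a))⁻¹ * (Real.sqrt (1 + t ^ 2 * b))⁻¹) - c =
      t ^ 2 * ((Real.sqrt (1 + t ^ 2 * a))⁻¹ * (Real.sqrt (1 + t ^ 2 * b))⁻¹ *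
        (k - c * (a + b + t ^ 2 * a * b) / (1 + Real.sqrt (1 + t ^ 2 * a) * Real.sqrt (1 + t ^ 2 * b)))) := by
  set sx := Real.sqrt (1 + t ^ 2 * a) with hsx
  set sy := Real.sqrt (1 + t ^ 2 * b) with hsy
  have hDx : 0 < 1 + t ^ 2 * a := by positivity
  have hDy : 0 < 1 + t ^ 2 * b := by positivity
  have hsx0 : 0 < sx := Real.sqrt_pos.mpr hDx
  have hsy0 : 0 < sy := Real.sqrt_pos.mpr hDy
  have hsx2 : sx ^ 2 = 1 + t ^ 2 * a := Real.sq_sqrt hDx.le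
  have hsy2 : sy ^ 2 = 1 + t ^ 2 * b := Real.sq_sqrt hDy.le
  have hS : 0 < 1 + sx * sy := by positivity
  -- `t²(a + b + t²ab) = (sx sy)² − 1 = (sx sy − 1)(sx sy + 1)`
  have hprod : t ^ 2 * (a + b + t ^ 2 * a * b) = (sx * sy - 1) * (1 + sx * sy) := by
    have : (sx * sy) ^ 2 = (1 + t ^ 2 * a) * (1 + t ^ 2 * b) := by rw [mul_pow, hsx2, hsy2]
    nlinarith [this]
  have hdiv : c * (a + b + t ^ 2 * a * b) / (1 + sx * sy) * t ^ 2 = c * (sx * sy - 1) := by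
    rw [div_mul_eq_mul_div, mul_assoc, mul_comm (a + b + t ^ 2 * a * b), hprod, ← mul_assoc]
    field_simp
  have hρ : sx⁻¹ * sy⁻¹ * (sx * sy) = 1 := by
    field_simp
  -- expand
  have : t ^ 2 * (sx⁻¹ * sy⁻¹ * (k - c * (a + b + t ^ 2 * a * b) / (1 + sx * sy))) =
      sx⁻¹ * sy⁻¹ * (t ^ 2 * k) - sx⁻¹ * sy⁻¹ * (c * (a + b + t ^ 2 * a * b) / (1 + sx * sy) * t ^ 2) := by ring
  rw [this, hdiv]
  have h2 : sx⁻¹ * sy⁻¹ * (c * (sx * sy - 1)) = c - c * (sx⁻¹ * sy⁻¹) := by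
    have : sx⁻¹ * sy⁻¹ * (c * (sx * sy - 1)) = c * (sx⁻¹ * sy⁻¹ * (sx * sy)) - c * (sx⁻¹ * sy⁻¹) := by ring
    rw [this, hρ, mul_one]
  rw [h2]
  ring

/-- The bracket of `key_identity` is continuous in `t` (`a, b ≥ 0`). [folklore] -/
theorem continuous_bracket (c k a b : ℝ) (ha : 0 ≤ a) (hb : 0 ≤ b) :
    Continuous fun t : ℝ => (Real.sqrt (1 + t ^ 2 * a))⁻¹ * (Real.sqrt (1 + t ^ 2 * b))⁻¹ *
      (k - c * (a + b + t ^ 2 * a * b) / (1 + Real.sqrt (1 + t ^ 2 * a) * Real.sqrt (1 + t ^ 2 * b))) := by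
  have hsx : ∀ t : ℝ, Real.sqrt (1 + t ^ 2 * a) ≠ 0 := fun t => (Real.sqrt_pos.mpr (by positivity)).ne'
  have hsy : ∀ t : ℝ, Real.sqrt (1 + t ^ 2 * b) ≠ 0 := fun t => (Real.sqrt_pos.mpr (by positivity)).ne'
  have hS : ∀ t : ℝ, 1 + Real.sqrt (1 + t ^ 2 * a) * Real.sqrt (1 + t ^ 2 * b) ≠ 0 := fun t => by positivity
  have h1 : Continuous fun t : ℝ => Real.sqrt (1 + t ^ 2 * a) := by fun_prop
  have h2 : Continuous fun t : ℝ => Real.sqrt (1 + t ^ 2 * b) := by fun_prop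
  refine ((h1.inv₀ hsx).mul (h2.inv₀ hsy)).mul ?_
  refine continuous_const.sub ?_
  exact Continuous.div (by fun_prop) (continuous_const.add (h1.mul h2)) hS

/-- The bracket at `t = 0` is `k − c(a + b)/2`. [folklore] -/
theorem bracket_zero (c k a b : ℝ) :
    (Real.sqrt (1 + (0 : ℝ) ^ 2 * a))⁻¹ * (Real.sqrt (1 + (0 : ℝ) ^ 2 * b))⁻¹ *
      (k - c * (a + b + (0 : ℝ) ^ 2 * a * b) / (1 + Real.sqrt (1 + (0 : ℝ) ^ 2 * a) * Real.sqrt (1 + (0 : ℝ) ^ 2 * b))) =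
      k - c * (a + b) / 2 := by
  simp only [zero_pow two_ne_zero, zero_mul, add_zero, Real.sqrt_one, inv_one, one_mul, mul_one]
  norm_num

/-! ## §2 A continuous function non-positive off the origin is non-positive at the origin -/

/-- If `f` is continuous and `f t ≤ 0` for every `t ≠ 0`, then `f 0 ≤ 0`. [folklore] -/
theorem le_of_forall_ne_zero {f : ℝ → ℝ} (hf : Continuous f) (h : ∀ t : ℝ, t ≠ 0 → f t ≤ 0) : f 0 ≤ 0 := by
  have ht : Tendsto f (𝓝[≠] (0 : ℝ)) (𝓝 (f 0)) := (hf.tendsto 0).mono_left nhdsWithin_le_nhds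
  exact le_of_tendsto ht (eventually_nhdsWithin_of_forall fun t ht0 => h t ht0)

/-! ## §3 The abstract `t → 0` step -/

/-- ★★ **SECOND VARIATION FROM TWO-SIDED MINIMALITY, ABSTRACTLY.**  For families `p q v w : ι → ℝ⁴` on a finite set `s` (no unit or orthogonality
hypothesis needed): if for EVERY real `t` the varied correlations do not exceed the unvaried ones,
`Σ_{b∈s} γ_{p_b}^{v_b}(t)·γ_{q_b}^{w_b}(t) ≤ Σ_{b∈s} p_b·q_b` with `γ_p^v(t) = (1 + t²|v|²)^{−1/2}(p + t v)`, then the summed second variation at `t = 0`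
is non-positive: `Σ_{b∈s} (2·v_b·w_b − (p_b·q_b)(|v_b|² + |w_b|²)) ≤ 0`.  (`±t` symmetrisation ✓`varPt_dot_varPt_add_neg`, `key_identity`, continuity.)
Flat use: `v_b := η_x·v_a(u_x)`, `w_b := η_y·v_a(u_y)` (§4); twisted use (★w8 g6): `w_b := η_y·v_{S_b a}(R_b u_y)`. [cite: Xin1980, p.609–613; folklore] -/
theorem sum_hessianForm_nonpos_of_forall_dot_le {ι : Type*} (s : Finset ι) (p q v w : ι → Fin 4 → ℝ)
    (hmin : ∀ t : ℝ, ∑ b ∈ s, dotProduct ((Real.sqrt (1 + t ^ 2 * dotProduct (v b) (v b)))⁻¹ • (p b + t • v b))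
        ((Real.sqrt (1 + t ^ 2 * dotProduct (w b) (w b)))⁻¹ • (q b + t • w b)) ≤ ∑ b ∈ s, dotProduct (p b) (q b)) :
    ∑ b ∈ s, (2 * dotProduct (v b) (w b) - dotProduct (p b) (q b) * (dotProduct (v b) (v b) + dotProduct (w b) (w b))) ≤ 0 := by
  have hnn : ∀ z : Fin 4 → ℝ, 0 ≤ dotProduct z z := fun z => by
    show 0 ≤ ∑ i, z i * z i
    exact Finset.sum_nonneg fun i _ => mul_self_nonneg (z i)
  set cc : ι → ℝ := fun b => dotProduct (p b) (q b) with hcc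
  set kk : ι → ℝ := fun b => dotProduct (v b) (w b) with hkk
  set A : ι → ℝ := fun b => dotProduct (v b) (v b) with hA
  set Bq : ι → ℝ := fun b => dotProduct (w b) (w b) with hBq
  have hA0 : ∀ b, 0 ≤ A b := fun b => hnn _
  have hB0 : ∀ b, 0 ≤ Bq b := fun b => hnn _
  set G : ι → ℝ → ℝ := fun b t => (Real.sqrt (1 + t ^ 2 * A b))⁻¹ * (Real.sqrt (1 + t ^ 2 * Bq b))⁻¹ *
    (kk b - cc b * (A b + Bq b + t ^ 2 * A b * Bq b) / (1 + Real.sqrt (1 + t ^ 2 * A b) * Real.sqrt (1 + t ^ 2 * Bq b))) with hG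
  have hGcont : Continuous fun t => ∑ b ∈ s, G b t :=
    continuous_finsetSum _ fun b _ => continuous_bracket (cc b) (kk b) (A b) (Bq b) (hA0 b) (hB0 b)
  -- two-sided minimality ⇒ `Σ_b [(c + t²k)ρ − c] ≤ 0`
  have hsym : ∀ t : ℝ, ∑ b ∈ s, ((cc b + t ^ 2 * kk b) * ((Real.sqrt (1 + t ^ 2 * A b))⁻¹ * (Real.sqrt (1 + t ^ 2 * Bq b))⁻¹) - cc b) ≤ 0 := by
    intro t
    have h1 := hmin t
    have h2 := hmin (-t)
    have hid : ∀ b, dotProduct ((Real.sqrt (1 + t ^ 2 * dotProduct (v b) (v b)))⁻¹ • (p b + t • v b))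
            ((Real.sqrt (1 + t ^ 2 * dotProduct (w b) (w b)))⁻¹ • (q b + t • w b)) +
          dotProduct ((Real.sqrt (1 + (-t) ^ 2 * dotProduct (v b) (v b)))⁻¹ • (p b + (-t) • v b))
            ((Real.sqrt (1 + (-t) ^ 2 * dotProduct (w b) (w b)))⁻¹ • (q b + (-t) • w b)) =
          2 * (dotProduct (p b) (q b) + t ^ 2 * dotProduct (v b) (w b)) *
            ((Real.sqrt (1 + t ^ 2 * dotProduct (v b) (v b)))⁻¹ * (Real.sqrt (1 + t ^ 2 * dotProduct (w b) (w b)))⁻¹) :=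
      fun b => varPt_dot_varPt_add_neg (p b) (q b) (v b) (w b) t
    have hsum := add_le_add h1 h2
    rw [← Finset.sum_add_distrib, ← two_mul] at hsum
    simp only [hid] at hsum
    have : ∑ b ∈ s, ((cc b + t ^ 2 * kk b) * ((Real.sqrt (1 + t ^ 2 * A b))⁻¹ * (Real.sqrt (1 + t ^ 2 * Bq b))⁻¹) - cc b) =
        (∑ b ∈ s, 2 * (dotProduct (p b) (q b) + t ^ 2 * dotProduct (v b) (w b)) *
            ((Real.sqrt (1 + t ^ 2 * dotProduct (v b) (v b)))⁻¹ * (Real.sqrt (1 + t ^ 2 * dotProduct (w b) (w b)))⁻¹) -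
          2 * ∑ b ∈ s, dotProduct (p b) (q b)) / 2 := by
      rw [Finset.mul_sum, ← Finset.sum_sub_distrib, Finset.sum_div]
      refine Finset.sum_congr rfl fun b _ => ?_
      simp only [hcc, hkk, hA, hBq]
      ring
    rw [this]
    exact div_nonpos_of_nonpos_of_nonneg (by linarith) (by norm_num)
  -- the key identity: for every `t`, `Σ_b [...] = t² · Σ_b G b t`
  have hGle : ∀ t : ℝ, t ≠ 0 → (∑ b ∈ s, G b t) ≤ 0 := by
    intro t ht
    have h := hsym t
    have hrw : ∑ b ∈ s, ((cc b + t ^ 2 * kk b) * ((Real.sqrt (1 + t ^ 2 * A b))⁻¹ * (Real.sqrt (1 + t ^ 2 * Bq b))⁻¹) - cc b) =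
        t ^ 2 * ∑ b ∈ s, G b t := by
      rw [Finset.mul_sum]
      exact Finset.sum_congr rfl fun b _ => key_identity (cc b) (kk b) (A b) (Bq b) t (hA0 b) (hB0 b)
    rw [hrw] at h
    have ht2 : 0 < t ^ 2 := by positivity
    by_contra hcon
    push Not at hcon
    have : 0 < t ^ 2 * ∑ b ∈ s, G b t := mul_pos ht2 hcon
    linarith
  -- continuity at `0`
  have h0 := le_of_forall_ne_zero hGcont hGle
  have hG0 : ∀ b, G b 0 = kk b - cc b * (A b + Bq b) / 2 := fun b => bracket_zero (cc b) (kk b) (A b) (Bq b)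
  simp only [hG0] at h0
  have hsplit : ∑ b ∈ s, (2 * dotProduct (v b) (w b) - dotProduct (p b) (q b) * (dotProduct (v b) (v b) + dotProduct (w b) (w b))) =
      2 * ∑ b ∈ s, (kk b - cc b * (A b + Bq b) / 2) := by
    rw [Finset.mul_sum]
    refine Finset.sum_congr rfl fun b _ => ?_
    simp only [hkk, hcc, hA, hBq]
    ring
  rw [hsplit]
  linarith

/-! ## §4 The graph stability inequality -/


/-- The varied map stays on the sphere: `U_t^a(x)` is a unit vector (`u_x` unit). [folklore] -/
theorem varied_dot_self {V : Type*} (u : V → Fin 4 → ℝ) (hu : ∀ x, dotProduct (u x) (u x) = 1) (η : V → ℝ) (a : Fin 4) (t : ℝ) (x : V) :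
    dotProduct
      ((Real.sqrt (1 + t ^ 2 * dotProduct (η x • (Pi.single a 1 - dotProduct (Pi.single a 1) (u x) • u x))
          (η x • (Pi.single a 1 - dotProduct (Pi.single a 1) (u x) • u x))))⁻¹ •
        (u x + t • (η x • (Pi.single a 1 - dotProduct (Pi.single a 1) (u x) • u x))))
      ((Real.sqrt (1 + t ^ 2 * dotProduct (η x • (Pi.single a 1 - dotProduct (Pi.single a 1) (u x) • u x))
          (η x • (Pi.single a 1 - dotProduct (Pi.single a 1) (u x) • u x))))⁻¹ •
        (u x + t • (η x • (Pi.single a 1 - dotProduct (Pi.single a 1) (u x) • u x)))) = 1 := by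
  apply varPt_dot_self (hu x)
  rw [smul_dotProduct, tang_dot_self_pt a (hu x), smul_zero]

/-- ★★★ **THE STABILITY (LEUNG–XIN ∕ KAJIGAYA) INEQUALITY ON A FINITE GRAPH, WITH A CUTOFF.**  Let `u : V → S³ ⊂ ℝ⁴` (unit vectors) on a finite set of
bonds `B` (`src tgt : B → V`), `η : V → ℝ` any vertex weight.  If for each coordinate field `a` and EVERY `t ∈ ℝ` the varied map
`U_t^a(x) = (1 + t²|V_a(x)|²)^{−1/2}(u_x + t V_a(x))`, `V_a(x) = η_x(e_a − (e_a·u_x)u_x)`, satisfies `Σ_b U_t^a(src b)·U_t^a(tgt b) ≤ Σ_b u(src b)·u(tgt b)`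
(energy-minimality along the four Leung–Xin curves), then
`Σ_b η_{src}η_{tgt}·e_b·(1 + e_b/2) ≤ 3·Σ_b c_b·(η_{src} − η_{tgt})²`, `e_b = |u_x − u_y|²`, `c_b = u_x·u_y` — the energy term carries the sign
`2 − n = −1` of the three-sphere.  With `η` a ball cutoff: `E(B_{R/2}) ≲ #bonds(B_R)·R⁻² ≍ R^{d−2}` from stability alone.
[cite: Xin1980, p.609–613; Kajigaya 2023, Ann. Mat. Pura Appl., Thm 1.2] -/
theorem graph_stability {V B : Type*} [Fintype B] (src tgt : B → V) (u : V → Fin 4 → ℝ) (hu : ∀ x, dotProduct (u x) (u x) = 1)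
    (η : V → ℝ)
    (hmin : ∀ (a : Fin 4) (t : ℝ),
      ∑ b, dotProduct
        ((Real.sqrt (1 + t ^ 2 * dotProduct (η (src b) • (Pi.single a 1 - dotProduct (Pi.single a 1) (u (src b)) • u (src b)))
            (η (src b) • (Pi.single a 1 - dotProduct (Pi.single a 1) (u (src b)) • u (src b)))))⁻¹ •
          (u (src b) + t • (η (src b) • (Pi.single a 1 - dotProduct (Pi.single a 1) (u (src b)) • u (src b)))))
        ((Real.sqrt (1 + t ^ 2 * dotProduct (η (tgt b) • (Pi.single a 1 - dotProduct (Pi.single a 1) (u (tgt b)) • u (tgt b)))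
            (η (tgt b) • (Pi.single a 1 - dotProduct (Pi.single a 1) (u (tgt b)) • u (tgt b)))))⁻¹ •
          (u (tgt b) + t • (η (tgt b) • (Pi.single a 1 - dotProduct (Pi.single a 1) (u (tgt b)) • u (tgt b))))) ≤
      ∑ b, dotProduct (u (src b)) (u (tgt b))) :
    ∑ b, η (src b) * η (tgt b) * (dotProduct (u (src b) - u (tgt b)) (u (src b) - u (tgt b)) *
        (1 + dotProduct (u (src b) - u (tgt b)) (u (src b) - u (tgt b)) / 2)) ≤
      3 * ∑ b, dotProduct (u (src b)) (u (tgt b)) * (η (src b) - η (tgt b)) ^ 2 := by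
  -- Step 1: for each field `a`, the `t → 0` consequence of two-sided minimality (§3 at the Leung–Xin fields)
  have hfield : ∀ a : Fin 4,
      ∑ b, (2 * dotProduct (η (src b) • (Pi.single a 1 - dotProduct (Pi.single a 1) (u (src b)) • u (src b)))
              (η (tgt b) • (Pi.single a 1 - dotProduct (Pi.single a 1) (u (tgt b)) • u (tgt b))) -
            dotProduct (u (src b)) (u (tgt b)) *
              (dotProduct (η (src b) • (Pi.single a 1 - dotProduct (Pi.single a 1) (u (src b)) • u (src b)))
                  (η (src b) • (Pi.single a 1 - dotProduct (Pi.single a 1) (u (src b)) • u (src b))) +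
                dotProduct (η (tgt b) • (Pi.single a 1 - dotProduct (Pi.single a 1) (u (tgt b)) • u (tgt b)))
                  (η (tgt b) • (Pi.single a 1 - dotProduct (Pi.single a 1) (u (tgt b)) • u (tgt b))))) ≤ 0 :=
    fun a => sum_hessianForm_nonpos_of_forall_dot_le Finset.univ (fun b => u (src b)) (fun b => u (tgt b))
      (fun b => η (src b) • (Pi.single a 1 - dotProduct (Pi.single a 1) (u (src b)) • u (src b)))
      (fun b => η (tgt b) • (Pi.single a 1 - dotProduct (Pi.single a 1) (u (tgt b)) • u (tgt b))) (hmin a)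
  -- Step 2: sum over the four fields and use the sphere identity per bond
  have hsum4 : ∑ a : Fin 4, ∑ b,
      (2 * dotProduct (η (src b) • (Pi.single a 1 - dotProduct (Pi.single a 1) (u (src b)) • u (src b)))
          (η (tgt b) • (Pi.single a 1 - dotProduct (Pi.single a 1) (u (tgt b)) • u (tgt b))) -
        dotProduct (u (src b)) (u (tgt b)) *
          (dotProduct (η (src b) • (Pi.single a 1 - dotProduct (Pi.single a 1) (u (src b)) • u (src b)))
              (η (src b) • (Pi.single a 1 - dotProduct (Pi.single a 1) (u (src b)) • u (src b))) +
            dotProduct (η (tgt b) • (Pi.single a 1 - dotProduct (Pi.single a 1) (u (tgt b)) • u (tgt b)))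
              (η (tgt b) • (Pi.single a 1 - dotProduct (Pi.single a 1) (u (tgt b)) • u (tgt b))))) ≤ 0 :=
    Finset.sum_nonpos fun a _ => hfield a
  rw [Finset.sum_comm] at hsum4
  -- per bond: the inner sum over `a` is the bond Hessian with `α = η_x`, `β = η_y`
  have hper : ∀ b, ∑ a : Fin 4,
      (2 * dotProduct (η (src b) • (Pi.single a 1 - dotProduct (Pi.single a 1) (u (src b)) • u (src b)))
          (η (tgt b) • (Pi.single a 1 - dotProduct (Pi.single a 1) (u (tgt b)) • u (tgt b))) -
        dotProduct (u (src b)) (u (tgt b)) *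
          (dotProduct (η (src b) • (Pi.single a 1 - dotProduct (Pi.single a 1) (u (src b)) • u (src b)))
              (η (src b) • (Pi.single a 1 - dotProduct (Pi.single a 1) (u (src b)) • u (src b))) +
            dotProduct (η (tgt b) • (Pi.single a 1 - dotProduct (Pi.single a 1) (u (tgt b)) • u (tgt b)))
              (η (tgt b) • (Pi.single a 1 - dotProduct (Pi.single a 1) (u (tgt b)) • u (tgt b))))) =
      2 * η (src b) * η (tgt b) * (2 + dotProduct (u (src b)) (u (tgt b)) ^ 2) -
        3 * dotProduct (u (src b)) (u (tgt b)) * (η (src b) ^ 2 + η (tgt b) ^ 2) := by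
    intro b
    rw [← sum_bondHessian_eq (u (src b)) (u (tgt b)) (hu _) (hu _) (η (src b)) (η (tgt b))]
    refine Finset.sum_congr rfl fun a _ => ?_
    simp only [smul_dotProduct, dotProduct_smul, smul_eq_mul]
    ring
  simp only [hper] at hsum4
  -- convert with the second-variation form
  have hfin : ∑ b, (6 * dotProduct (u (src b)) (u (tgt b)) * (η (src b) - η (tgt b)) ^ 2 -
      2 * η (src b) * η (tgt b) * dotProduct (u (src b) - u (tgt b)) (u (src b) - u (tgt b)) *
        (1 + dotProduct (u (src b) - u (tgt b)) (u (src b) - u (tgt b)) / 2)) ≥ 0 := by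
    have : ∑ b, (6 * dotProduct (u (src b)) (u (tgt b)) * (η (src b) - η (tgt b)) ^ 2 -
        2 * η (src b) * η (tgt b) * dotProduct (u (src b) - u (tgt b)) (u (src b) - u (tgt b)) *
          (1 + dotProduct (u (src b) - u (tgt b)) (u (src b) - u (tgt b)) / 2)) =
        ∑ b, (-2) * (2 * η (src b) * η (tgt b) * (2 + dotProduct (u (src b)) (u (tgt b)) ^ 2) -
          3 * dotProduct (u (src b)) (u (tgt b)) * (η (src b) ^ 2 + η (tgt b) ^ 2)) := by
      refine Finset.sum_congr rfl fun b _ => ?_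
      rw [← sum_bondHessian_eq (u (src b)) (u (tgt b)) (hu _) (hu _), ← sum_secondVariation_eq (u (src b)) (u (tgt b)) (hu _) (hu _)]
    rw [this, ← Finset.mul_sum]
    nlinarith [hsum4]
  have hsplit : ∑ b, (6 * dotProduct (u (src b)) (u (tgt b)) * (η (src b) - η (tgt b)) ^ 2 -
      2 * η (src b) * η (tgt b) * dotProduct (u (src b) - u (tgt b)) (u (src b) - u (tgt b)) *
        (1 + dotProduct (u (src b) - u (tgt b)) (u (src b) - u (tgt b)) / 2)) =
      2 * (3 * ∑ b, dotProduct (u (src b)) (u (tgt b)) * (η (src b) - η (tgt b)) ^ 2) -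
        2 * ∑ b, η (src b) * η (tgt b) * (dotProduct (u (src b) - u (tgt b)) (u (src b) - u (tgt b)) *
          (1 + dotProduct (u (src b) - u (tgt b)) (u (src b) - u (tgt b)) / 2)) := by
    rw [Finset.mul_sum, Finset.mul_sum, Finset.mul_sum, ← Finset.sum_sub_distrib]
    refine Finset.sum_congr rfl fun b _ => ?_
    ring
  rw [hsplit] at hfin
  linarith

end Summit.QuantumFields.YangMills.Theorems.PoincareLipschitzLeungXinGraphStability
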